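import Mathlib
import Summits.Ventures.PercRepro2.Defs

/-!
# Step functions on the trace lattice `2^{w, v}` (blind cell PercRepro2, night-2 g3;
proofs/NIGHT2-DARC.md §16)

The positive-association inputs of the two-vertex pendant theorem (`CoinTwoPendant.lean`) come
from `trace_bhk` applied to functionals of the trace `K⁻ ∩ {w, v}` taking prescribed values on the
four traces `∅, {v}, {w}, {w, v}`.  `stepFn w v c₀ c₁ c₂ c₃` is that functional, extended to all
of `Set V` through membership of `w` and `v`; below are its evaluation lemmas and the
monotonicity / nonnegativity criteria `trace_bhk` asks for.
-/

namespace Summit.Ventures.PercRepro2.Coin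

section Step

open Classical

variable {V : Type*} {R : Type*}

/-- The step function on `2^{w, v}`: `c₀` at `∅`, `c₁` at `{v}`, `c₂` at `{w}`, `c₃` at `{w, v}`
(read off membership of `w` and `v`). -/
noncomputable def stepFn (w v : V) (c₀ c₁ c₂ c₃ : R) (S : Set V) : R :=
  if w ∈ S then (if v ∈ S then c₃ else c₂) else (if v ∈ S then c₁ else c₀)

variable {w v : V} {c₀ c₁ c₂ c₃ : R}

/-- `stepFn` at the empty trace. -/
lemma stepFn_empty : stepFn w v c₀ c₁ c₂ c₃ (∅ : Set V) = c₀ := by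
  simp [stepFn]

/-- `stepFn` at the trace `{v}`. -/
lemma stepFn_v (hwv : w ≠ v) : stepFn w v c₀ c₁ c₂ c₃ ({v} : Set V) = c₁ := by
  simp [stepFn, hwv]

/-- `stepFn` at the trace `{w}`. -/
lemma stepFn_w (hwv : w ≠ v) : stepFn w v c₀ c₁ c₂ c₃ ({w} : Set V) = c₂ := by
  simp [stepFn, hwv.symm]

/-- `stepFn` at the trace `{w, v}`. -/
lemma stepFn_wv : stepFn w v c₀ c₁ c₂ c₃ ({w, v} : Set V) = c₃ := by
  simp [stepFn]

/-- A step function is monotone iff its values increase along the Boolean lattice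
`∅ ⊂ {v}, {w} ⊂ {w, v}` (sufficiency). -/
lemma monotone_stepFn [Preorder R] (h₀₁ : c₀ ≤ c₁) (h₀₂ : c₀ ≤ c₂) (h₁₃ : c₁ ≤ c₃)
    (h₂₃ : c₂ ≤ c₃) : Monotone (stepFn w v c₀ c₁ c₂ c₃) := by
  intro S S' hSS'
  unfold stepFn
  by_cases hw : w ∈ S <;> by_cases hv : v ∈ S
  · rw [if_pos hw, if_pos hv, if_pos (hSS' hw), if_pos (hSS' hv)]
  · rw [if_pos hw, if_neg hv, if_pos (hSS' hw)]
    by_cases hv' : v ∈ S'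
    · rw [if_pos hv']; exact h₂₃
    · rw [if_neg hv']
  · rw [if_neg hw, if_pos hv]
    by_cases hw' : w ∈ S'
    · rw [if_pos hw', if_pos (hSS' hv)]; exact h₁₃
    · rw [if_neg hw', if_pos (hSS' hv)]
  · rw [if_neg hw, if_neg hv]
    by_cases hw' : w ∈ S' <;> by_cases hv' : v ∈ S'
    · rw [if_pos hw', if_pos hv']; exact h₀₁.trans h₁₃
    · rw [if_pos hw', if_neg hv']; exact h₀₂
    · rw [if_neg hw', if_pos hv']; exact h₀₁
    · rw [if_neg hw', if_neg hv']

/-- A step function with nonnegative values is nonnegative. -/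
lemma stepFn_nonneg [Zero R] [Preorder R] (h₀ : 0 ≤ c₀) (h₁ : 0 ≤ c₁) (h₂ : 0 ≤ c₂)
    (h₃ : 0 ≤ c₃) (S : Set V) : 0 ≤ stepFn w v c₀ c₁ c₂ c₃ S := by
  unfold stepFn
  by_cases hw : w ∈ S <;> by_cases hv : v ∈ S
  · rw [if_pos hw, if_pos hv]; exact h₃
  · rw [if_pos hw, if_neg hv]; exact h₂
  · rw [if_neg hw, if_pos hv]; exact h₁
  · rw [if_neg hw, if_neg hv]; exact h₀

end Step

end Summit.Ventures.PercRepro2.Coin
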